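import Literature.Probability.Percolation.AdjSepGeom
import Literature.Probability.Percolation.ArmSeparationOutSepFour
import Literature.Probability.Percolation.ArmSeparationOutLanding
import HarnessLib

/-!
# Where the pieces of the corridors of the adjacent landing are, pair by pair

Topic `Literature/Probability/Percolation`; family `crit-perc` / near-critical percolation on `𝕋`.
A brick of the near-critical arm-separation theorem for four arms in the ADJACENT colour
arrangement (P. Nolin, EJP 13 (2008), Thm. 11, `j = 4`, `σ = BBWW` [arXiv 0711.4948: Thm. 10],
landing step, §4.3 Prop. 12 and Lemma 13, §4.4): the generic geometry of the disjointness of the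
corridors of the four exits (needed twice: the two corridors of one colour must be disjoint for the
landed event `extOpenDuoR`, and the supports of the two colours for Nolin's Lemma 13
[arXiv Lemma 12]), in the rotation-read world. Three tools:

* **sectors**: a set of frame points with `u₁ ≤ -1`, `1 ≤ u₀ + u₁` lands, under `ρ^i`, in the near
  sector of the side `i` (`image_rot_subset_sectorNear`); such sets on different sides are disjoint
  (`disjoint_image_rot_of_ne`) — spokes of any length, approach strips, target strips, exterior
  footprints of the clean routes all qualify (`spokeBox_sector`, `strip_sector`, `zoneBox_sector`);
* **norm bands**: the boxes of an arc of the thin ring `(r, e, s)` have norms in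
  `[r - s - 2e, r + 2e]` (the tree's `norm_of_mem_boxAll_arc`), so they miss every set of other norms
  (`boxAll_arc_disjoint_of_norm`); norms of rotated frame points (`norm_of_mem_image_rot'`);
* **windows**: the boxes of an arc miss a rotated radial band whose window on the arc's ring reads
  off the arc (`boxAll_arc_disjoint_rotRows`, from `ringTube_disjoint_rotRows`).

Everything here is proved; no named facts are introduced.

## References

* P. Nolin, Near-critical percolation in two dimensions, *Electron. J. Probab.* 13 (2008), §4.3
  Prop. 12, Lemma 13, §4.4 (arXiv 0711.4948: Prop. 11, Lemma 12; proof of Thm. 10) [Nolin2008].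
-/

noncomputable section

open Set

namespace Literature.Probability.Percolation

open LatticeModels Tube

/-! ### Sectors -/

/-- **Frame points in the open cone of the side land in its near sector.** [folklore] -/
theorem image_rot_subset_sectorNear {i : ℕ} (hi : i < 6) {B : Set (Site 2)} (hB : ∀ u ∈ B, u 1 ≤ -1 ∧ 1 ≤ u 0 + u 1) :
    triRotIsoPow i '' B ⊆ sectorNear i 1 := by
  rintro v ⟨u, hu, rfl⟩
  exact (rot_mem_sectorNear_iff hi).2 (hB u hu)

/-- **Sets in the cones of different sides are disjoint after rotation.** [cite: Nolin2008, §4.3 Lemma 13 (arXiv 0711.4948: Lemma 12, disjoint supports)] -/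
theorem disjoint_image_rot_of_ne {i j : ℕ} (hi : i < 6) (hj : j < 6) (hij : i ≠ j) {B B' : Set (Site 2)}
    (hB : ∀ u ∈ B, u 1 ≤ -1 ∧ 1 ≤ u 0 + u 1) (hB' : ∀ u ∈ B', u 1 ≤ -1 ∧ 1 ≤ u 0 + u 1) :
    Disjoint (triRotIsoPow i '' B) (triRotIsoPow j '' B') :=
  Set.disjoint_of_subset (image_rot_subset_sectorNear hi hB) (image_rot_subset_sectorNear hj hB')
    (disjoint_sectorNear hi hj hij (by norm_num))

/-- The spoke box lies in the cone of its side (middle rows: `ξ + 2ε ≤ -1`; beyond the side). [folklore] -/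
theorem spokeBox_sector {M k : ℕ} {T₀ : ℤ} {w L ε : ℕ} (htop : T₀ + w + k + (k / 4 : ℕ) + 2 * ε ≤ -1)
    (hbot : 1 - (2 * (M : ℤ) + k) ≤ T₀ + w + k + (k / 4 : ℕ)) :
    ∀ u ∈ (extSpokeTube M k T₀ w L ε).box, u 1 ≤ -1 ∧ 1 ≤ u 0 + u 1 := by
  intro u hu
  rw [Tube.mem_box] at hu
  simp only [extSpokeTube, Nat.cast_mul, Nat.cast_ofNat] at hu
  constructor <;> omega

/-- A strip beyond the column `a ≥ 1 - b` with rows `≤ -1` lies in the cone. [folklore] -/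
theorem strip_sector {a b : ℤ} {W h : ℕ} (htop : b + h ≤ -1) (hbot : 1 - a ≤ b) :
    ∀ u ∈ triStrip a b W h, u 1 ≤ -1 ∧ 1 ≤ u 0 + u 1 := by
  intro u hu
  rw [mem_triStrip] at hu
  constructor <;> omega

/-- **The exterior footprint box of an exit** (window start `T₀`, width `w`, scale `k`): depths
`(2M, 2M + 2k + 1]`, rows `(T₀, T₀ + w + 3k)`. [folklore] -/
def zoneBox (M k : ℕ) (T₀ : ℤ) (w : ℕ) : Set (Site 2) :=
  {u | 2 * (M : ℤ) + 1 ≤ u 0 ∧ u 0 ≤ 2 * (M : ℤ) + 2 * k + 1 ∧ T₀ + 1 ≤ u 1 ∧ u 1 + 1 ≤ T₀ + w + 3 * k}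

/-- The footprint box lies in the cone of its side (`T₀ + w + 3k ≤ 0`, `-2M ≤ T₀`). [folklore] -/
theorem zoneBox_sector {M k : ℕ} {T₀ : ℤ} {w : ℕ} (htop : T₀ + w + 3 * k ≤ 0) (hbot : -(2 * (M : ℤ)) ≤ T₀) :
    ∀ u ∈ zoneBox M k T₀ w, u 1 ≤ -1 ∧ 1 ≤ u 0 + u 1 := by
  intro u hu
  obtain ⟨h1, h2, h3, h4⟩ := hu
  constructor <;> omega

/-! ### Norms -/

/-- **Norms of rotated frame points in the cone**: the depth `u₀` (`0 ≤ u₀`, `-u₀ ≤ u₁ ≤ 0`). [folklore] -/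
theorem norm_of_mem_image_rot' {i : ℕ} {B : Set (Site 2)} (hB : ∀ u ∈ B, 0 ≤ u 0 ∧ -(u 0) ≤ u 1 ∧ u 1 ≤ 0)
    {v : Site 2} (hv : v ∈ triRotIsoPow i '' B) : ∃ u ∈ B, triRotIsoPow i u = v ∧ triNorm v = u 0 := by
  obtain ⟨u, hu, rfl⟩ := hv
  obtain ⟨h0, h1, h1'⟩ := hB u hu
  refine ⟨u, hu, rfl, ?_⟩
  rw [triNorm_rot]
  apply le_antisymm
  · exact triNorm_le_iff_lin.2 (by omega)
  · exact le_triNorm_iff_lin.2 (Or.inl le_rfl)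

/-- **An arc misses every set of other norms.** [folklore] -/
theorem boxAll_arc_disjoint_of_norm {r e s a len : ℕ} (he : 2 * e ≤ r)
    {X : Set (Site 2)} (hX : ∀ v ∈ X, triNorm v < (r : ℤ) - s - 2 * e ∨ (r : ℤ) + 2 * e < triNorm v) :
    Disjoint (boxAll (arc (thinRing r e s) a len)) X := by
  rw [Set.disjoint_left]
  intro v hv hvX
  obtain ⟨h1, h2⟩ := norm_of_mem_boxAll_arc he hv
  rcases hX v hvX with h | h <;> omega

/-- Rotations preserve norm statements. [folklore] -/
theorem forall_norm_image_rot {j : ℕ} {X : Set (Site 2)} {p : ℤ → Prop} (hX : ∀ v ∈ X, p (triNorm v)) :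
    ∀ v ∈ triRotIsoPow j '' X, p (triNorm v) := by
  rintro v ⟨u, hu, rfl⟩; rw [triNorm_rot]; exact hX u hu

/-! ### Windows -/

/-- **An arc misses a rotated radial band read off the arc.** The arc of the ring `(r, e, s)`
(`n s = r`) from `a` of length `len`; the set `B` of frame points with rows in `[y₁, y₂]` in the cone
and beyond the side; every position of the window of the side `ic` spanned by the lateral indices
`latIdx y₁ - 2, …, latIdx y₂ + 1` reads OFF the arc. [cite: Nolin2008, §4.3 Lemma 13 (arXiv 0711.4948: Lemma 12)] -/
theorem boxAll_arc_disjoint_rotRows {r e s n a len ic M : ℕ} {B : Set (Site 2)} {y₁ y₂ lamS : ℤ}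
    (hn : 1 ≤ n) (hns : n * s = r) (he : 2 * e ≤ r) (ha : a < 12 * n - 4) (hlen : len ≤ 12 * n - 4) (hic : ic < 6)
    (h2 : 2 ≤ latIdx s r y₁) (hιn : latIdx s r y₂ + 3 ≤ n) (hy1 : -(r : ℤ) ≤ y₁)
    (hwin : ∀ g, blockOff n ic + 2 * (latIdx s r y₁ - 2) ≤ g → g ≤ blockOff n ic + 2 * (latIdx s r y₂ - 2) + 7 →
      ¬ InArc (12 * n - 4) a len g)
    (hes : 3 * e < s) (hlam : 2 * (e : ℤ) < lamS)
    (hrows : ∀ u ∈ B, y₁ ≤ u 1 ∧ u 1 ≤ y₂)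
    (hsec : ∀ u ∈ B, u 1 ≤ -lamS ∧ lamS ≤ u 0 + u 1)
    (hdep : ∀ u ∈ B, 2 * (M : ℤ) + 1 ≤ u 0 ∧ -(2 * (M : ℤ)) ≤ u 1 ∧ u 1 ≤ 0) :
    Disjoint (boxAll (arc (thinRing r e s) a len)) (triRotIsoPow ic '' B) := by
  have hs : 1 ≤ s := by omega
  have hr : n = r / s := by rw [← hns, Nat.mul_div_cancel _ hs]
  rw [Set.disjoint_left]
  intro v hv hvB
  obtain ⟨T, hT, hvT⟩ := hv
  subst hr
  obtain ⟨g, hg, hin, rfl⟩ := exists_pos_of_mem_arc hn ha hlen hT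
  have hout : g < blockOff (r / s) ic + 2 * (latIdx s r y₁ - 2) ∨ blockOff (r / s) ic + 2 * (latIdx s r y₂ - 2) + 7 < g := by
    by_contra h
    push Not at h
    exact hwin g h.1 h.2 hin
  exact ringTube_disjoint_rotRows (M := M) hn hns he hg hic h2 hιn hy1 hout hes hlam hrows hsec hdep hvT hvB

end Literature.Probability.Percolation
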